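import Mathlib
import Summits.ResolutionOfSingularities.ResolutionOfSingularities.Theorems.WeightedInvariantLocalWeightedDropTOT2CurveConflictDivTwo

/-!
# `LocalWeightedDrop`, TOT2-LINE regime (P), piece (B1a): a non-zero series in `k⟦u₁,u₂⟧` vanishes on only FINITELY MANY graph curves
# `u₂ = u₁·h(u₁)` — the counting half of the finiteness of top-locus graph branches

Crux item stmt-ResolutionOfSingularities-8899 `WeightedInvariant.LocalWeightedDrop` (route `ResolutionOfSingularities/WeightedInvariant`), ENGINE
skeleton v33 (35b29332b4d99231), registered stub `stub_regimePresented`; TOT2-LINE v1.3 §3 (P3)/(B1) (`L/res-L1-w43-lead-1/g5/TOT2-LINE-v1.3.md`):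
res-type-088's conflict budget sums over the top-locus graph branches of a label; their finiteness is «a non-zero `h`-independent witness `D(u₁,u₂)`
killed along every branch» (piece (B1b)) + THIS counting lemma.  [OURS · L1 W4.3 · chain w43 · seat res-L1-w43-lead-1 gen 5; def-free; elementary
power-series algebra on res-type-088's `u₂`-free part `subst ![X 0, 0]` (…TOT2CurveConflictShift/DivTwo) and the shear `MonicDescent.shear`;
nothing here is a statement of any manuscript; AI-produced, gate-checked, weaker than expert review.]

THE EVALUATION ALONG A GRAPH CURVE.  For `h = h(u₁)` (`u₂`-free) and `D ∈ k⟦u₁,u₂⟧`, `D(u₁, u₁h)` is `subst ![X 0, 0] (shear h D)` (shear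
`u₂ ↦ u₂ + u₁h`, then kill `u₂`).
* `killTwo_shear_X_zero/X_one/of_noY`, `killTwo_shear_mul/sub` — the evaluation is multiplicative, fixes `u₂`-free series, sends `u₂ ↦ u₁h`;
* `eq_mul_of_killTwo_shear_eq_zero` — if `D(u₁,u₁h₀) = 0` then `D = (u₂ − u₁h₀) · D₂` (shear back the `u₂`-divisibility);
* `coeff_single_one_of_eq_mul` — then the `u₂`-axis coefficients of `D₂` are those of `D` shifted down by one;
* **`finite_curveRoots_of_coeff_single_one_ne_zero`** — if `D` has a non-zero coefficient on the `u₂`-axis, `{h u₂-free | D(u₁,u₁h) = 0}` is finite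
  (induction on the least such exponent: peel one root at a time, the other roots pass to `D₂` since `u₁(h − h₀) ≠ 0`);
* **`finite_curveRoots`** — for every `D ≠ 0` (remove the `u₁`-power first: `CobordantVertexChart.exists_eq_X_pow_mul_not_dvd`).
-/

set_option linter.dupNamespace false -- mandated namespace of this single-conjunct summit

noncomputable section

namespace Summit.ResolutionOfSingularities.ResolutionOfSingularities.Theorems

namespace TOT2Curve

open MvPowerSeries PolyDescent MonicDescent Literature.AlgebraicGeometry.Resolution

variable {k : Type} [Field k]

/-! ## The evaluation `D ↦ D(u₁, u₁h)` -/

/-- `u₁(u₁, u₁h) = u₁`. -/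
theorem killTwo_shear_X_zero (h : MvPowerSeries (Fin 2) k) :
    subst (![X 0, 0] : Fin 2 → MvPowerSeries (Fin 2) k) (shear h (X 0)) = X 0 := by
  rw [shear_X_zero, subst_X hasSubst_killTwo]
  rfl

/-- The evaluation fixes `u₂`-free series. -/
theorem killTwo_shear_of_noY (h g : MvPowerSeries (Fin 2) k) (hg : ∀ e : Fin 2 →₀ ℕ, e 1 ≠ 0 → coeff e g = 0) :
    subst (![X 0, 0] : Fin 2 → MvPowerSeries (Fin 2) k) (shear h g) = g := by
  rw [shear_eq_self_of_noY h g hg, killTwo_of_noY g hg]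

/-- `u₂(u₁, u₁h) = u₁h` for `u₂`-free `h`. -/
theorem killTwo_shear_X_one (h : MvPowerSeries (Fin 2) k) (hh : ∀ e : Fin 2 →₀ ℕ, e 1 ≠ 0 → coeff e h = 0) :
    subst (![X 0, 0] : Fin 2 → MvPowerSeries (Fin 2) k) (shear h (X 1)) = X 0 * h := by
  rw [shear_X_one, subst_add hasSubst_killTwo, subst_mul hasSubst_killTwo, subst_X hasSubst_killTwo, subst_X hasSubst_killTwo,
    killTwo_of_noY h hh]
  change (0 : MvPowerSeries (Fin 2) k) + X 0 * h = X 0 * h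
  rw [zero_add]

/-- The evaluation is multiplicative. -/
theorem killTwo_shear_mul (h A B : MvPowerSeries (Fin 2) k) :
    subst (![X 0, 0] : Fin 2 → MvPowerSeries (Fin 2) k) (shear h (A * B)) =
      subst (![X 0, 0] : Fin 2 → MvPowerSeries (Fin 2) k) (shear h A) * subst (![X 0, 0] : Fin 2 → MvPowerSeries (Fin 2) k) (shear h B) := by
  rw [shear_mul, subst_mul hasSubst_killTwo]

/-- The evaluation is subtractive. -/
theorem killTwo_shear_sub (h A B : MvPowerSeries (Fin 2) k) :
    subst (![X 0, 0] : Fin 2 → MvPowerSeries (Fin 2) k) (shear h (A - B)) =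
      subst (![X 0, 0] : Fin 2 → MvPowerSeries (Fin 2) k) (shear h A) - subst (![X 0, 0] : Fin 2 → MvPowerSeries (Fin 2) k) (shear h B) := by
  rw [shear_eq, shear_eq, shear_eq, subst_sub (hasSubst_of_constantCoeff_zero (constantCoeff_shearFamily h)), subst_sub hasSubst_killTwo]

/-- The evaluation of the line `u₂ − u₁h₀` along `u₂ = u₁h` is `u₁(h − h₀)`. -/
theorem killTwo_shear_line (h h₀ : MvPowerSeries (Fin 2) k) (hh : ∀ e : Fin 2 →₀ ℕ, e 1 ≠ 0 → coeff e h = 0)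
    (hh₀ : ∀ e : Fin 2 →₀ ℕ, e 1 ≠ 0 → coeff e h₀ = 0) :
    subst (![X 0, 0] : Fin 2 → MvPowerSeries (Fin 2) k) (shear h (X 1 - X 0 * h₀)) = X 0 * (h - h₀) := by
  rw [killTwo_shear_sub, killTwo_shear_X_one h hh, killTwo_shear_mul, killTwo_shear_X_zero, killTwo_shear_of_noY h h₀ hh₀, mul_sub]

/-! ## Peeling one root -/

/-- **A ROOT GIVES A LINEAR FACTOR**: if `D(u₁, u₁h₀) = 0` for a `u₂`-free `h₀`, then `D = (u₂ − u₁h₀) · D₂`. -/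
theorem eq_mul_of_killTwo_shear_eq_zero {D h₀ : MvPowerSeries (Fin 2) k} (hh₀ : ∀ e : Fin 2 →₀ ℕ, e 1 ≠ 0 → coeff e h₀ = 0)
    (hD : subst (![X 0, 0] : Fin 2 → MvPowerSeries (Fin 2) k) (shear h₀ D) = 0) :
    ∃ D₂ : MvPowerSeries (Fin 2) k, D = (X 1 - X 0 * h₀) * D₂ := by
  obtain ⟨G, hG⟩ := (X_one_dvd_iff_killTwo_eq_zero (shear h₀ D)).mpr hD
  refine ⟨shear (-h₀) G, ?_⟩
  have hneg : ∀ e : Fin 2 →₀ ℕ, e 1 ≠ 0 → coeff e (-h₀) = 0 := fun e he => by rw [map_neg, hh₀ e he, neg_zero]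
  have hback : shear (-h₀) (shear h₀ D) = D := by
    rw [shear_shear_of_noY (-h₀) h₀ D hh₀, neg_add_cancel, shear_zero_eq]
  rw [← hback, hG, shear_mul, shear_X_one]
  ring

/-- The `u₂`-axis coefficients of `(u₂ − u₁h₀)·D₂` are those of `D₂` shifted up by one. -/
theorem coeff_single_one_of_eq_mul (h₀ D₂ : MvPowerSeries (Fin 2) k) (n : ℕ) :
    coeff (Finsupp.single 1 (n + 1)) ((X 1 - X 0 * h₀) * D₂) = coeff (Finsupp.single 1 n) D₂ := by
  rw [sub_mul, map_sub, mul_assoc]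
  have h1 : coeff (Finsupp.single (1 : Fin 2) (n + 1)) (X 1 * D₂) = coeff (Finsupp.single 1 n) D₂ := by
    rw [show (Finsupp.single (1 : Fin 2) (n + 1)) = Finsupp.single 1 n + Finsupp.single 1 1 by rw [← Finsupp.single_add],
      X, coeff_monomial_mul]  -- `X 1 = monomial (single 1 1) 1`
    · simp
  have h0 : coeff (Finsupp.single (1 : Fin 2) (n + 1)) (X 0 * (h₀ * D₂)) = 0 := by
    rw [X, coeff_monomial_mul]
    rw [if_neg]
    intro hle
    have := hle 0
    simp at this
  rw [h1, h0, sub_zero]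

/-! ## Finiteness of the roots -/

/-- **FINITELY MANY GRAPH CURVES IN THE ZERO SET, axis form**: if `D` has a non-zero coefficient at `u₂^n` and zero coefficients at `u₂^m`, `m < n`, on
the `u₂`-axis, then only finitely many `u₂`-free `h` have `D(u₁, u₁h) = 0` (indeed at most `n`). -/
theorem finite_curveRoots_of_coeff_single_one_ne_zero :
    ∀ (n : ℕ) (D : MvPowerSeries (Fin 2) k), coeff (Finsupp.single 1 n) D ≠ 0 → (∀ m < n, coeff (Finsupp.single 1 m) D = 0) →
      Set.Finite {h : MvPowerSeries (Fin 2) k | (∀ e : Fin 2 →₀ ℕ, e 1 ≠ 0 → coeff e h = 0) ∧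
        subst (![X 0, 0] : Fin 2 → MvPowerSeries (Fin 2) k) (shear h D) = 0} := by
  intro n
  induction n with
  | zero =>
    intro D hD _
    -- no root at all: the evaluation keeps the constant term
    suffices he : {h : MvPowerSeries (Fin 2) k | (∀ e : Fin 2 →₀ ℕ, e 1 ≠ 0 → coeff e h = 0) ∧
        subst (![X 0, 0] : Fin 2 → MvPowerSeries (Fin 2) k) (shear h D) = 0} = ∅ by
      rw [he]; exact Set.finite_empty
    ext h
    simp only [Set.mem_setOf_eq, Set.mem_empty_iff_false, iff_false, not_and]
    intro _ hzero
    apply hD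
    have hc : constantCoeff (subst (![X 0, 0] : Fin 2 → MvPowerSeries (Fin 2) k) (shear h D)) = constantCoeff D := by
      rw [constantCoeff_killTwo, shear_eq, constantCoeff_subst_of_constantCoeff_zero _ (constantCoeff_shearFamily h)]
    rw [hzero, map_zero] at hc
    rw [Finsupp.single_zero, coeff_zero_eq_constantCoeff_apply]
    exact hc.symm
  | succ n ih =>
    intro D hD hlow
    by_cases hne : {h : MvPowerSeries (Fin 2) k | (∀ e : Fin 2 →₀ ℕ, e 1 ≠ 0 → coeff e h = 0) ∧
        subst (![X 0, 0] : Fin 2 → MvPowerSeries (Fin 2) k) (shear h D) = 0}.Nonempty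
    · obtain ⟨h₀, hh₀, hroot⟩ := hne
      obtain ⟨D₂, hD₂⟩ := eq_mul_of_killTwo_shear_eq_zero hh₀ hroot
      -- `D₂` has its first non-zero axis coefficient at `n`
      have hD₂n : coeff (Finsupp.single 1 n) D₂ ≠ 0 := by
        rw [← coeff_single_one_of_eq_mul h₀ D₂ n, ← hD₂]; exact hD
      have hD₂low : ∀ m < n, coeff (Finsupp.single 1 m) D₂ = 0 := by
        intro m hm
        rw [← coeff_single_one_of_eq_mul h₀ D₂ m, ← hD₂]
        exact hlow (m + 1) (by omega)
      refine ((ih D₂ hD₂n hD₂low).insert h₀).subset ?_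
      rintro h ⟨hh, hzero⟩
      by_cases hhh : h = h₀
      · exact Or.inl hhh
      · right
        refine ⟨hh, ?_⟩
        -- `0 = D(u₁,u₁h) = u₁(h − h₀) · D₂(u₁,u₁h)` and `u₁(h − h₀) ≠ 0`
        rw [hD₂, killTwo_shear_mul, killTwo_shear_line h h₀ hh hh₀] at hzero
        refine (mul_eq_zero.mp hzero).resolve_left ?_
        exact mul_ne_zero (X_ne_zero' (0 : Fin 2)) (sub_ne_zero.mpr hhh)
    · rw [Set.not_nonempty_iff_eq_empty] at hne
      rw [hne]
      exact Set.finite_empty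

/-- **FINITELY MANY GRAPH CURVES IN THE ZERO SET OF A NON-ZERO SERIES**: for `D ≠ 0` in `k⟦u₁,u₂⟧`, only finitely many `u₂`-free `h` have
`D(u₁, u₁h(u₁)) = 0`. -/
theorem finite_curveRoots {D : MvPowerSeries (Fin 2) k} (hD : D ≠ 0) :
    Set.Finite {h : MvPowerSeries (Fin 2) k | (∀ e : Fin 2 →₀ ℕ, e 1 ≠ 0 → coeff e h = 0) ∧
      subst (![X 0, 0] : Fin 2 → MvPowerSeries (Fin 2) k) (shear h D) = 0} := by
  classical
  -- remove the `u₁`-power: `D = u₁^a · D₁`, `u₁ ∤ D₁`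
  obtain ⟨a, D₁, hD₁, hndvd⟩ := CobordantVertexChart.exists_eq_X_pow_mul_not_dvd hD
  -- `D₁` has a non-zero coefficient on the `u₂`-axis; take the least
  have hex : ∃ m, coeff (Finsupp.single (1 : Fin 2) m) D₁ ≠ 0 := by
    by_contra hall
    push Not at hall
    apply hndvd
    rw [X_dvd_iff]
    intro e he
    have heq : e = Finsupp.single 1 (e 1) := by
      ext i; fin_cases i
      · simpa using he
      · simp
    rw [heq]
    exact hall (e 1)
  let n := Nat.find hex
  have hn : coeff (Finsupp.single (1 : Fin 2) n) D₁ ≠ 0 := Nat.find_spec hex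
  have hlow : ∀ m < n, coeff (Finsupp.single (1 : Fin 2) m) D₁ = 0 := fun m hm => by
    have := Nat.find_min hex hm
    push Not at this
    exact this
  refine (finite_curveRoots_of_coeff_single_one_ne_zero n D₁ hn hlow).subset ?_
  rintro h ⟨hh, hzero⟩
  refine ⟨hh, ?_⟩
  -- `u₁^a · D₁(u₁,u₁h) = 0 ⇒ D₁(u₁,u₁h) = 0`
  have hpow : subst (![X 0, 0] : Fin 2 → MvPowerSeries (Fin 2) k) (shear h (X 0 ^ a)) = X 0 ^ a := by
    rw [shear_eq, subst_pow (hasSubst_of_constantCoeff_zero (constantCoeff_shearFamily h)), ← shear_eq, subst_pow hasSubst_killTwo,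
      killTwo_shear_X_zero]
  rw [hD₁, killTwo_shear_mul, hpow] at hzero
  exact (mul_eq_zero.mp hzero).resolve_left (pow_ne_zero a (X_ne_zero' (0 : Fin 2)))

end TOT2Curve

end Summit.ResolutionOfSingularities.ResolutionOfSingularities.Theorems

end
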